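import Mathlib

/-!
# Full-row designs: the odd-point ownership count and the grid label bound for `≤ 3` rows
(solo-informed gen 91, CLAIMS c700–c702; dossier `work/g87/cyc/CYC.md` §12)

The FULL-ROW sub-problem of the `K_{a,c}` grid label bound (`CYC.md` §11(g)): cells `(r,m)` (`r` a row, `m` a column),
an abelian group `G` of exponent two with cell vectors `e (r,m)` and a parity character `π` (`π (e t) = 1`), and for every
row `r` a set `S r` of EVEN points such that a two-cell difference `X + Y = e b₁ + e b₂` between a point of type `p` and a
point of type `q` is only allowed when `{b₁,b₂}` avoids the rows `p` and `q` or is the vertical `p–q` pair of one column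
(`FRAllowed`), distinct types being disjoint.  The grid label bound for this family reads `|C| · Σ_r |S r| ≤ |G| / 2`.

MECHANISM (new here; it is invisible to the level-1 type SDP, which gives `513.49 > 512` for `K_{3,4}`).  Every typed point
`X ∈ S r` OWNS its `|C|` odd neighbours `X + e (r,m)`; `|C| Σ_r |S r| = Σ_U |own U|` (`sum_card_own`).  The owners of one
odd point lie in a single column with distinct rows (`own_col`); the foreign odd neighbours `X + e b` (`b` not in row `r`) of
a typed point are owned by nobody (`own_foreign_eq_empty`); two owners `t, t'` of `U` make `U + e t + e t'` such a ZERO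
point carrying a CROSSED PAIR, and two crossed pairs at one point whose row pairs meet coincide (`crossed_core`,
`crossed_unique`).  With at most three rows any two row pairs meet, so `(U,t) ↦ U`, `(U,{t,t'}) ↦ U + e t + e t'` embeds
the ownership incidences into the odd points: `two_mul_value_le_card` (`2 |C| Σ_r |S r| ≤ |G|`), and for the concrete
grid `F_2^{a × c}`, `a ≤ 3`: `grid_fullRow_bound` (`2 c Σ_r |S r| ≤ 2^{ac}`, i.e. `Σ_r |S r| ≤ 2^{ac-1}/c`; `K_{3,4}`: `≤ 512`).
-/

namespace Summit.MatrixMultiplication.MatrixMultiplication.Theorems.SoloVal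

open Finset

section FullRow

variable {G : Type*} [AddCommGroup G]
variable {R C : Type*}

/-- The compatibility rule of a full-row design: a two-cell difference `{b₁,b₂}` between a point of type `p` and a point of
type `q` must avoid the rows `p` and `q`, or (for `p ≠ q`) be the vertical `p–q` pair of one column. -/
def FRAllowed (p q : R) (b₁ b₂ : R × C) : Prop :=
  (b₁.1 ≠ p ∧ b₁.1 ≠ q ∧ b₂.1 ≠ p ∧ b₂.1 ≠ q) ∨
  (p ≠ q ∧ b₁.2 = b₂.2 ∧ ((b₁.1 = p ∧ b₂.1 = q) ∨ (b₁.1 = q ∧ b₂.1 = p)))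

/-- A full-row design over the cell vectors `e`: one point set per row (its type), distinct types disjoint, and every
two-cell difference between typed points allowed by `FRAllowed`. -/
structure FullRowDesign (e : R × C → G) where
  /-- the points of type `r` -/
  S : R → Finset G
  /-- distinct types are disjoint -/
  disj : ∀ p q, p ≠ q → ∀ X ∈ S p, X ∉ S q
  /-- the two-cell difference rule -/
  cond : ∀ p q, ∀ X ∈ S p, ∀ Y ∈ S q, ∀ b₁ b₂ : R × C, b₁ ≠ b₂ → X + Y = e b₁ + e b₂ → FRAllowed p q b₁ b₂

variable {e : R × C → G} (D : FullRowDesign e)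

/-- A crossed pair at `V`: column `m`, rows `r ≠ s`, with `V + e (s,m)` of type `r` and `V + e (r,m)` of type `s`. -/
def FullRowDesign.IsCrossed (V : G) (m : C) (r s : R) : Prop :=
  r ≠ s ∧ V + e (s, m) ∈ D.S r ∧ V + e (r, m) ∈ D.S s

/-- Crossed pairs are symmetric in the two rows. -/
theorem FullRowDesign.IsCrossed.symm {V : G} {m : C} {r s : R} (h : D.IsCrossed V m r s) : D.IsCrossed V m s r :=
  ⟨h.1.symm, h.2.2, h.2.1⟩

/-- CORE OF LEMMA 3.  Two crossed pairs at `V` sharing their first row share the second row and the column. -/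
theorem FullRowDesign.crossed_core (h2 : ∀ g : G, g + g = 0) {V : G} {m₁ m₂ : C} {r s₁ s₂ : R}
    (h₁ : D.IsCrossed V m₁ r s₁) (h₂ : D.IsCrossed V m₂ r s₂) : s₁ = s₂ ∧ m₁ = m₂ := by
  have hP : V + e (s₁, m₁) ∈ D.S r := h₁.2.1
  have hQ : V + e (r, m₂) ∈ D.S s₂ := h₂.2.2
  have hne : ((s₁, m₁) : R × C) ≠ (r, m₂) := fun h => h₁.1 (Prod.mk.inj h).1.symm
  have hsum : V + e (s₁, m₁) + (V + e (r, m₂)) = e (s₁, m₁) + e (r, m₂) := by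
    have : V + e (s₁, m₁) + (V + e (r, m₂)) = V + V + (e (s₁, m₁) + e (r, m₂)) := by abel
    rw [this, h2, zero_add]
  rcases D.cond r s₂ _ hP _ hQ _ _ hne hsum with ⟨-, -, h, -⟩ | ⟨-, hm, ⟨h, -⟩ | ⟨h, -⟩⟩
  · exact absurd rfl h
  · exact absurd h.symm h₁.1
  · exact ⟨h, hm⟩

variable [Fintype R]

/-- LEMMA 3 for at most three rows.  Two crossed pairs at the same point coincide (same column, same row pair). -/
theorem FullRowDesign.crossed_unique (hR : Fintype.card R ≤ 3) (h2 : ∀ g : G, g + g = 0) {V : G}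
    {m₁ m₂ : C} {r₁ s₁ r₂ s₂ : R} (h₁ : D.IsCrossed V m₁ r₁ s₁) (h₂ : D.IsCrossed V m₂ r₂ s₂) :
    m₁ = m₂ ∧ ((r₁ = r₂ ∧ s₁ = s₂) ∨ (r₁ = s₂ ∧ s₁ = r₂)) := by
  classical
  by_cases hrr : r₁ = r₂
  · subst hrr
    obtain ⟨hs, hm⟩ := D.crossed_core h2 h₁ h₂
    exact ⟨hm, Or.inl ⟨rfl, hs⟩⟩
  by_cases hrs : r₁ = s₂
  · subst hrs
    obtain ⟨hs, hm⟩ := D.crossed_core h2 h₁ h₂.symm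
    exact ⟨hm, Or.inr ⟨rfl, hs⟩⟩
  by_cases hsr : s₁ = r₂
  · subst hsr
    obtain ⟨hs, hm⟩ := D.crossed_core h2 h₁.symm h₂
    exact ⟨hm, Or.inr ⟨hs, rfl⟩⟩
  by_cases hss : s₁ = s₂
  · subst hss
    obtain ⟨hs, hm⟩ := D.crossed_core h2 h₁.symm h₂.symm
    exact ⟨hm, Or.inl ⟨hs, rfl⟩⟩
  -- four distinct rows contradict `|R| ≤ 3`
  exfalso
  have h4 : ({r₁, s₁, r₂, s₂} : Finset R).card = 4 := by
    rw [card_insert_of_notMem, card_insert_of_notMem, card_pair h₂.1]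
    · simp only [mem_insert, mem_singleton, not_or]; exact ⟨hsr, hss⟩
    · simp only [mem_insert, mem_singleton, not_or]; exact ⟨h₁.1, hrr, hrs⟩
  have := card_le_univ ({r₁, s₁, r₂, s₂} : Finset R)
  omega

variable [Fintype C] [DecidableEq G]

/-- The owners of a point `U`: cells `t = (r,m)` with `U + e t` of type `r`. -/
def FullRowDesign.own (U : G) : Finset (R × C) :=
  univ.filter (fun t => U + e t ∈ D.S t.1)

/-- Membership in the owner set. -/
theorem FullRowDesign.mem_own {U : G} {t : R × C} : t ∈ D.own U ↔ U + e t ∈ D.S t.1 := by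
  simp [FullRowDesign.own]

/-- LEMMA 1.  Two distinct owners of one point lie in different rows of the same column. -/
theorem FullRowDesign.own_col (h2 : ∀ g : G, g + g = 0) {U : G} {t u : R × C} (ht : t ∈ D.own U)
    (hu : u ∈ D.own U) (htu : t ≠ u) : t.1 ≠ u.1 ∧ t.2 = u.2 := by
  rw [D.mem_own] at ht hu
  have hsum : U + e t + (U + e u) = e t + e u := by
    have : U + e t + (U + e u) = U + U + (e t + e u) := by abel
    rw [this, h2, zero_add]
  rcases D.cond _ _ _ ht _ hu t u htu hsum with ⟨h, -⟩ | ⟨h, hc, -⟩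
  · exact absurd rfl h
  · exact ⟨h, hc⟩

/-- LEMMA 2 (zero points).  A foreign odd neighbour `X + e b` (`b` outside the row of `X`) of a typed point has no owner. -/
theorem FullRowDesign.own_foreign_eq_empty (h2 : ∀ g : G, g + g = 0) {X : G} {r : R} (hX : X ∈ D.S r)
    {b : R × C} (hb : b.1 ≠ r) : D.own (X + e b) = ∅ := by
  refine eq_empty_iff_forall_notMem.2 fun s hs => ?_
  rw [D.mem_own] at hs
  by_cases hsb : s = b
  · subst hsb
    have hXs : X + e s + e s = X := by rw [add_assoc, h2, add_zero]
    rw [hXs] at hs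
    exact D.disj r s.1 (fun h => hb h.symm) X hX hs
  · have hsum : X + e b + e s + X = e s + e b := by
      have : X + e b + e s + X = X + X + (e s + e b) := by abel
      rw [this, h2, zero_add]
    rcases D.cond _ _ _ hs _ hX s b hsb hsum with ⟨h, -⟩ | ⟨hsr, -, ⟨-, h⟩ | ⟨h, -⟩⟩
    · exact absurd rfl h
    · exact hb h
    · exact hsr h

/-- A crossed pair sits at a zero point. -/
theorem FullRowDesign.own_eq_empty_of_crossed (h2 : ∀ g : G, g + g = 0) {V : G} {m : C} {r s : R}
    (h : D.IsCrossed V m r s) : D.own V = ∅ := by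
  have hV : V = V + e (s, m) + e (s, m) := by rw [add_assoc, h2, add_zero]
  rw [hV]
  exact D.own_foreign_eq_empty h2 h.2.1 (b := (s, m)) h.1.symm

/-- Two distinct owners `t, t'` of `U` produce the crossed pair (column of `t`; rows of `t`, `t'`) at `U + e t + e t'`. -/
theorem FullRowDesign.crossed_of_owners (h2 : ∀ g : G, g + g = 0) {U : G} {t t' : R × C} (ht : t ∈ D.own U)
    (ht' : t' ∈ D.own U) (htt : t ≠ t') : D.IsCrossed (U + (e t + e t')) t.2 t.1 t'.1 := by
  obtain ⟨hr, hc⟩ := D.own_col h2 ht ht' htt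
  rw [D.mem_own] at ht ht'
  refine ⟨hr, ?_, ?_⟩
  · have : (t'.1, t.2) = t' := Prod.ext rfl hc
    rw [this, add_assoc, add_assoc, h2, add_zero]; exact ht
  · have : (t.1, t.2) = t := rfl
    rw [this, add_comm (e t) (e t'), add_assoc, add_assoc, h2, add_zero]; exact ht'

/-- THE VALUE IDENTITY.  `Σ_U |own U| = |C| · Σ_r |S r|`: every typed point owns exactly `|C|` points. -/
theorem FullRowDesign.sum_card_own [Fintype G] :
    ∑ U, (D.own U).card = Fintype.card C * ∑ r, (D.S r).card := by
  have h1 : ∀ U : G, (D.own U).card = ∑ t : R × C, if U + e t ∈ D.S t.1 then 1 else 0 := by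
    intro U; rw [FullRowDesign.own, card_filter]
  simp_rw [h1]
  rw [sum_comm]
  have h2 : ∀ t : R × C, (∑ U : G, if U + e t ∈ D.S t.1 then 1 else 0) = (D.S t.1).card := by
    intro t
    rw [← card_filter]
    apply card_bij (fun U _ => U + e t)
    · intro U hU; exact (mem_filter.1 hU).2
    · intro U₁ _ U₂ _ h; exact add_right_cancel h
    · intro X hX; exact ⟨X - e t, by simp [hX], by simp⟩
  simp_rw [h2]
  rw [Fintype.sum_prod_type]
  simp [sum_const, mul_sum]

/-- Arithmetic of the charging: `n ≤ [n ≠ 0] + C(n,2)`. -/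
theorem le_indicator_add_choose_two (n : ℕ) [Decidable (0 < n)] :
    n ≤ (if 0 < n then 1 else 0) + n.choose 2 := by
  rcases Nat.eq_zero_or_pos n with rfl | hn
  · simp
  · rw [if_pos hn]
    obtain ⟨k, rfl⟩ : ∃ k, n = k + 1 := ⟨n - 1, by omega⟩
    have h : (k + 1).choose 2 = k.choose 1 + k.choose 2 := Nat.choose_succ_succ k 1
    rw [Nat.choose_one_right] at h
    omega

/-- In `ZMod 2`, `z + 1 = 0` forces `z = 1`. -/
theorem zmod2_eq_one_of_add_one {z : ZMod 2} (h : z + 1 = 0) : z = 1 := by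
  revert z; decide

omit [DecidableEq G] in
/-- ODD-POINT OWNERSHIP THEOREM (a ≤ 3 rows).  For a full-row design on even points of an exponent-two group with parity
character `π` (`π (e t) = 1`), with at most three rows: `2 · |C| · Σ_r |S r| ≤ |G|`. -/
theorem FullRowDesign.two_mul_value_le_card [Fintype G] (hR : Fintype.card R ≤ 3) (h2 : ∀ g : G, g + g = 0)
    (π : G →+ ZMod 2) (hπ : ∀ t, π (e t) = 1) (hS : ∀ r, ∀ X ∈ D.S r, π X = 0) :
    2 * (Fintype.card C * ∑ r, (D.S r).card) ≤ Fintype.card G := by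
  classical
  -- degenerate case: no cells, the value is zero
  rcases isEmpty_or_nonempty (R × C) with hRC | hRC
  · have h0 : Fintype.card C * ∑ r, (D.S r).card = 0 := by
      rcases isEmpty_prod.1 hRC with hR' | hC'
      · haveI := hR'; simp
      · haveI := hC'; simp
    rw [h0]; exact Nat.zero_le _
  have t₀ : R × C := hRC.some
  -- the odd points, the owned points, the ownership pairs
  set Odd : Finset G := univ.filter (fun U => π U = 1) with hOdd
  set Owned : Finset G := univ.filter (fun U => 0 < (D.own U).card) with hOwned
  set Pairs := (univ : Finset G).sigma (fun U => (D.own U).powersetCard 2) with hPairs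
  have hOwnedOdd : Owned ⊆ Odd := by
    intro U hU
    obtain ⟨t, ht⟩ := card_pos.1 (mem_filter.1 hU).2
    rw [D.mem_own] at ht
    have := hS _ _ ht
    rw [map_add, hπ] at this
    exact mem_filter.2 ⟨mem_univ _, zmod2_eq_one_of_add_one this⟩
  -- step 1: value ≤ |Owned| + |Pairs|
  have step1 : Fintype.card C * ∑ r, (D.S r).card ≤ Owned.card + Pairs.card := by
    rw [← D.sum_card_own, hOwned, hPairs, card_sigma, card_filter, ← sum_add_distrib]
    refine sum_le_sum fun U _ => ?_
    rw [card_powersetCard]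
    exact le_indicator_add_choose_two (D.own U).card
  -- step 2: the map (U,{t,t'}) ↦ U + e t + e t' sends Pairs injectively into Odd \ Owned
  let f : (Σ _ : G, Finset (R × C)) → G := fun x => x.1 + ∑ y ∈ x.2, e y
  have key : ∀ x ∈ Pairs, ∃ t t' : R × C, t ≠ t' ∧ x.2 = {t, t'} ∧ t ∈ D.own x.1 ∧ t' ∈ D.own x.1 ∧
      f x = x.1 + (e t + e t') := by
    rintro ⟨U, p⟩ hx
    obtain ⟨hp, hc⟩ := mem_powersetCard.1 (mem_sigma.1 hx).2
    obtain ⟨t, t', htt, rfl⟩ := card_eq_two.1 hc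
    refine ⟨t, t', htt, rfl, hp (by simp), hp (by simp), ?_⟩
    show U + ∑ y ∈ {t, t'}, e y = U + (e t + e t')
    rw [sum_pair htt]
  have maps : ∀ x ∈ Pairs, f x ∈ Odd \ Owned := by
    intro x hx
    obtain ⟨t, t', htt, -, ht, ht', hfx⟩ := key x hx
    have hcr := D.crossed_of_owners h2 ht ht' htt
    rw [← hfx] at hcr
    refine mem_sdiff.2 ⟨mem_filter.2 ⟨mem_univ _, ?_⟩, fun h => ?_⟩
    · have h0 := hS _ _ hcr.2.1
      rw [map_add, hπ] at h0
      exact zmod2_eq_one_of_add_one h0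
    · have := (mem_filter.1 h).2
      rw [D.own_eq_empty_of_crossed h2 hcr, card_empty] at this
      exact lt_irrefl 0 this
  have inj : Set.InjOn f Pairs := by
    intro x hx x' hx' hxx
    obtain ⟨t, t', htt, hp, ht, ht', hfx⟩ := key x hx
    obtain ⟨u, u', huu, hp', hu, hu', hfx'⟩ := key x' hx'
    have hc1 := D.crossed_of_owners h2 ht ht' htt
    have hc2 := D.crossed_of_owners h2 hu hu' huu
    rw [← hfx] at hc1
    rw [← hfx', ← hxx] at hc2
    obtain ⟨hm, hrows⟩ := D.crossed_unique hR h2 hc1 hc2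
    have hct : t.2 = t'.2 := (D.own_col h2 ht ht' htt).2
    have hcu : u.2 = u'.2 := (D.own_col h2 hu hu' huu).2
    have hpp : x.2 = x'.2 := by
      rw [hp, hp']
      rcases hrows with ⟨h1, h1'⟩ | ⟨h1, h1'⟩
      · rw [Prod.ext h1 hm, Prod.ext h1' (hct.symm.trans (hm.trans hcu))]
      · rw [Prod.ext h1 (hm.trans hcu), Prod.ext h1' (hct.symm.trans hm), pair_comm]
    have hU : x.1 = x'.1 := by
      have h := hxx
      simp only [f, hpp] at h
      exact add_right_cancel h
    exact Sigma.ext hU (heq_of_eq hpp)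
  have step2 : Pairs.card ≤ (Odd \ Owned).card := card_le_card_of_injOn f maps inj
  -- step 3: |Odd| ≤ |G| / 2, by the translation `U ↦ U + e t₀` into the even points
  have step3 : 2 * Odd.card ≤ Fintype.card G := by
    set Even : Finset G := univ.filter (fun U => π U = 0) with hEven
    have hOE : Odd.card ≤ Even.card := by
      apply card_le_card_of_injOn (fun U => U + e t₀)
      · intro U hU
        have h1 : π U = 1 := (mem_filter.1 hU).2
        refine mem_filter.2 ⟨mem_univ _, ?_⟩
        rw [map_add, hπ, h1]; decide
      · intro U _ U' _ h; exact add_right_cancel h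
    have hdisj : Disjoint Odd Even := by
      rw [hOdd, hEven, disjoint_filter]; intro U _ h1 h0; rw [h1] at h0; exact absurd h0 (by decide)
    have hle : (Odd ∪ Even).card ≤ Fintype.card G := card_le_univ _
    rw [card_union_of_disjoint hdisj] at hle
    omega
  -- assemble
  have hsub : (Odd \ Owned).card + Owned.card = Odd.card := card_sdiff_add_card_eq_card hOwnedOdd
  omega

end FullRow

section Grid

/-- Parity of a point of `F_2^{a × c}` as an additive character. -/
def gridParity (a c : ℕ) : (Fin a × Fin c → ZMod 2) →+ ZMod 2 where
  toFun X := ∑ t, X t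
  map_zero' := by simp
  map_add' X Y := by simp [sum_add_distrib]

/-- THE FULL-ROW GRID LABEL BOUND FOR AT MOST THREE ROWS.  On the grid `F_2^{a × c}` with `a ≤ 3`, cell vectors the
standard basis, every full-row design on even points satisfies `2 · c · Σ_r |S r| ≤ 2^{a c}`, i.e.
`Σ_r |S r| ≤ 2^{ac-1} / c` (`K_{3,4}`: `≤ 512`; the level-1 type SDP only gives `513`). -/
theorem grid_fullRow_bound {a c : ℕ} (ha : a ≤ 3)
    (D : FullRowDesign (fun t : Fin a × Fin c => (Pi.single t (1 : ZMod 2) : Fin a × Fin c → ZMod 2)))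
    (hS : ∀ r, ∀ X ∈ D.S r, ∑ t, X t = 0) :
    2 * (c * ∑ r, (D.S r).card) ≤ 2 ^ (a * c) := by
  have hR : Fintype.card (Fin a) ≤ 3 := by simpa using ha
  have h2 : ∀ g : Fin a × Fin c → ZMod 2, g + g = 0 := by
    intro g; funext t; simp only [Pi.add_apply, Pi.zero_apply]; generalize g t = z; revert z; decide
  have hπ : ∀ t : Fin a × Fin c, gridParity a c (Pi.single t 1) = 1 := by
    intro t; simp [gridParity]
  have h := D.two_mul_value_le_card hR h2 (gridParity a c) hπ (fun r X hX => by simpa [gridParity] using hS r X hX)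
  simpa [Fintype.card_pi, ZMod.card, Fintype.card_prod, Fintype.card_fin, prod_const, card_univ] using h

end Grid

end Summit.MatrixMultiplication.MatrixMultiplication.Theorems.SoloVal
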